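import Summits.QuantumFields.YangMills.Theorems.AlphaInputsT3ACv2RecWindow
import Literature.MathematicalPhysics.QuantumFieldTheory.Balaban1983to89.BlockAveragingPlaquetteBoundLocal
import HarnessLib

/-!
# `UnitScaleTiltHistoryTailLocalProp1` — [Balaban1985Averaging] Prop. 1 for the route's averaging `blockAvg ℰp` IN LOCAL FORM, at the route's
# thresholds (helper for stmt-QuantumFields-19936 `HistoryTailL`; OWNER RULING g18-№3 §5 target of seat `ym3-torus-p2` gen 12)

The lane's `AlphaInputsT3AC.blockAvg_mem_windowT3` (`Theorems/AlphaInputsT3ACv2RecWindow.lean`) is the GLOBAL statement: a level-`k` field ALL of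
whose plaquettes are `θBal(K − k)`-small averages into the window `PlaqSmall (avgWindowFactor(L)·θBal(K − k))` of level `k + 1`.  The large-field
bookkeeping of [Balaban1985UV3] (38)–(41) (alpha-1's finding F-α1-10, fleet INBOX 06:07:26Z: the new small-field function `χ_{k+1}` lives on `Ω_{k+1}`
only, (39)–(40) p.266) needs the LOCAL statement: smallness of the fine plaquettes on a REGION gives smallness of the averaged plaquettes on the
region shrunk by a collar.  This file is that statement BY NAME for the T³ family, from the Literature module
`Balaban1983to89.BlockAveragingPlaquetteBoundLocal` (local crude Stokes + local Prop. 1):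

* `blockAvg_plaqSmallOn_of_near` — for `0 < γ ≤ 1`, `γ ≤ γwOf L b₀ p₀`, `k + 1 ≤ m + K` and ANY set `S′` of level-`(k+1)` plaquettes: if every level-`k`
  plaquette whose base block is within `ℓ^∞`-distance `1` of the corner of some `p′ ∈ S′` is `θBal(K − k)`-small, then `blockAvg ℰp U` is
  `avgWindowFactor(L)·θBal(K − k)`-small ON `S′`;
* `blockAvg_dist1_lt_of_near` — the one-plaquette form.
The collar needed is ONE block of scale `k + 1` in `ℓ^∞` around the corner block of each target plaquette (two blocks from the plaquette's far
corner), well inside the (39) collar `R·M` of the lane's `Carriers.Regions.Omega`; the identification «`plaqsIn (k+1) Ω_{k+1}` ⇒ the neighbourhood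
hypothesis from `PlaqSmallOn {q : plaqCover q ⊆ Ω_k}`» is region bookkeeping for the socket pen (alpha-1) and is NOT done here.
No `sorry`; nothing of Bałaban's estimates is asserted beyond the crude Prop. 1 already in the tree.

References: T. Bałaban, CMP 98 (1985) 17–51 [Balaban1985Averaging] (Prop. 1 (51) p.26); CMP 102 (1985) 255–275 [Balaban1985UV3] ((39)–(40) p.266).
-/

noncomputable section

namespace Summit.QuantumFields.YangMills.Theorems.HistoryTailLocalProp1

open Literature.MathematicalPhysics.QuantumFieldTheory.Balaban1983to89
open Literature.MathematicalPhysics.QuantumFieldTheory.Balaban1983to89.T3ContinuumYM3Torus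
open Literature.MathematicalPhysics.QuantumFieldTheory.Balaban1983to89.T3UnitLawDensityEML (ℰp)
open Literature.MathematicalPhysics.QuantumFieldTheory.Balaban1983to89.T3UnitScaleTilt (θBal)
open Literature.MathematicalPhysics.QuantumFieldTheory.Balaban1983to89.T3AlphaInputsAC
open Literature.MathematicalPhysics.QuantumFieldTheory.Balaban1983to89.BlockAveragingPlaquetteBoundLocal
  (dist1_plaqHol_avgFun_lt_of_near plaqSmallOn_avgFun_of_near)
open Literature.MathematicalPhysics.QuantumFieldTheory.Balaban1985CMP102
open Literature.MathematicalPhysics.QuantumFieldTheory.Balaban1985CMP102.Setting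
open Summit.QuantumFields.Balaban3D.Carriers
open Summit.QuantumFields.Balaban3D.Proofs.Primitives

/-- **LOCAL PROP. 1 AT THE ROUTE'S THRESHOLDS, one coarse plaquette**: for `0 < γ ≤ 1`, `γ ≤ γw(L, b₀, p₀)`, `k + 1 ≤ m + K` and a level-`(k+1)`
plaquette `p′` of run `K`: if every level-`k` plaquette `q` whose base block `blockOf q₋` is within `ℓ^∞`-distance `1` of the corner `p′₋`
(coordinatewise `p′₋ κ`, `p′₋ κ ± 1`) satisfies `dist1 (U(∂q)) < θBal(K − k)`, then `dist1 ((blockAvg ℰp U)(∂p′)) < avgWindowFactor(L)·θBal(K − k)`.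
[cite: Balaban1985Averaging, Prop. 1 (51) p.26] -/
theorem blockAvg_dist1_lt_of_near (F : T3Family) (𝔠 : AlphaConsts F.L (suGroupModel 2).N) {γ : ℝ} (hγ : 0 < γ) (hγ1 : γ ≤ 1)
    (hγw : γ ≤ AlphaInputsT3AC.γwOf F.L 𝔠.b₀ 𝔠.p₀) (K k : ℕ) (hk : k + 1 ≤ F.m + K)
    (U : GaugeField (F.P K) k (Matrix.specialUnitaryGroup (Fin 2) ℂ)) (p : Plaq (F.P K) (k + 1))
    (hU : ∀ q : Plaq (F.P K) k, (∀ κ, blockOf q.src κ = p.src κ ∨ blockOf q.src κ = p.src κ + 1 ∨ blockOf q.src κ = p.src κ - 1) →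
      dist1 (GaugeField.plaqHol U q) < θBal F.L γ 𝔠.b₀ 𝔠.p₀ (K - k)) :
    dist1 (GaugeField.plaqHol ((BlockAveraging.blockAvg (P := F.P K) (j := k) ℰp).avg U) p) <
      avgWindowFactor F.L * θBal F.L γ 𝔠.b₀ 𝔠.p₀ (K - k) := by
  have hL : 1 ≤ F.L := le_of_lt F.hL.2
  have hθ0 : 0 ≤ θBal F.L γ 𝔠.b₀ 𝔠.p₀ (K - k) :=
    (T3MinimiserStabilityReduction.θBal_pos hL hγ hγ1 𝔠.b₀_pos 𝔠.p₀ (K - k)).le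
  have hguard := AlphaInputsT3AC.guard_of_le_γwOf hL 𝔠.b₀ 𝔠.p₀ hγ hγw (K - k)
  have h := dist1_plaqHol_avgFun_lt_of_near (n := Fin 2) (P := F.P K) (j := k) hk hθ0 p hU hguard
  show dist1 (GaugeField.plaqHol (BlockAveraging.avgFun ℰp U) p) < avgWindowFactor F.L * θBal F.L γ 𝔠.b₀ 𝔠.p₀ (K - k)
  exact h

/-- **LOCAL PROP. 1 AT THE ROUTE'S THRESHOLDS, `PlaqSmallOn` form** (the local twin of `AlphaInputsT3AC.blockAvg_mem_windowT3`): for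
`0 < γ ≤ 1`, `γ ≤ γw(L, b₀, p₀)`, `k + 1 ≤ m + K` and any set `S′` of level-`(k+1)` plaquettes of run `K`: `θBal(K − k)`-smallness of the level-`k`
plaquettes based in the blocks at `ℓ^∞`-distance `≤ 1` from the corners of `S′` gives `avgWindowFactor(L)·θBal(K − k)`-smallness of `blockAvg ℰp U` ON
`S′` — the window `χ_{k+1}` of [Balaban1985UV3] (40) on a region, from small fields on the region plus a one-block collar.
[cite: Balaban1985Averaging, Prop. 1 (51) p.26; Balaban1985UV3, (39)-(40) p.266] -/
theorem blockAvg_plaqSmallOn_of_near (F : T3Family) (𝔠 : AlphaConsts F.L (suGroupModel 2).N) {γ : ℝ} (hγ : 0 < γ) (hγ1 : γ ≤ 1)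
    (hγw : γ ≤ AlphaInputsT3AC.γwOf F.L 𝔠.b₀ 𝔠.p₀) (K k : ℕ) (hk : k + 1 ≤ F.m + K)
    (U : GaugeField (F.P K) k (Matrix.specialUnitaryGroup (Fin 2) ℂ)) (S' : Set (Plaq (F.P K) (k + 1)))
    (hU : PlaqSmallOn {q : Plaq (F.P K) k | ∃ p ∈ S', ∀ κ, blockOf q.src κ = p.src κ ∨ blockOf q.src κ = p.src κ + 1 ∨
        blockOf q.src κ = p.src κ - 1} (θBal F.L γ 𝔠.b₀ 𝔠.p₀ (K - k)) U) :
    PlaqSmallOn S' (avgWindowFactor F.L * θBal F.L γ 𝔠.b₀ 𝔠.p₀ (K - k))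
      ((BlockAveraging.blockAvg (P := F.P K) (j := k) ℰp).avg U) :=
  fun p hp => blockAvg_dist1_lt_of_near F 𝔠 hγ hγ1 hγw K k hk U p (fun q hq => hU q ⟨p, hp, hq⟩)

end Summit.QuantumFields.YangMills.Theorems.HistoryTailLocalProp1

end
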